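import Summits.FinalStateConjecture.FinalStateConjecture.Theorems.ChannelsResolveTameDevelopmentsR.Negative.SubMinkowskiSettled
import Summits.FinalStateConjecture.FinalStateConjecture.Theorems.ChannelsResolveTameDevelopmentsR.Negative.SlabMinkowskiCharts
import HarnessLib

/-!
# The past cut `{x⁰ > −1}`: a COMPLETE, SETTLED, NON-MAXIMAL member of the flat model class — so Φ without
# `IsMaximal` is non-vacuously true there (support for the crux `ChannelsResolveTameDevelopmentsR`, K2R ≡ Φ,
# item `stmt-FinalStateConjecture-14075`, route PhotonSphereChannels; load-bearing analysis, part 4)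

Parts 2–3 (`SubMinkowskiCompleteness`, `SubMinkowskiSettled`) show that on the open sub-developments `η|_U` of
the trivial datum complete `𝓘⁺` ⟺ `{x⁰ ≥ 0} ⊆ U` ⟹ the development settles, so that Φ with `IsMaximal`
deleted holds on the class. This file exhibits a member showing that the deletion is REAL: the past-truncated
Minkowski space `η|_{x⁰ > −1}` (`pastCutDev`) is a vacuum Cauchy development of the trivial admissible datum
(`isCauchyHypersurface_pastCut`) which

* has COMPLETE future null infinity (`hasCompleteNullInfinity_pastCutDev`, part 2: it contains `{x⁰ ≥ 0}`),
* SETTLES (`settles_pastCutDev`, part 3: honest exhaustive `N = 0` decomposition of `{x⁰ ≥ 0}`), and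
* is NOT MAXIMAL (`pastCutDev_not_isMaximal`): Minkowski space does not embed into it — an isometric,
  time-orientation preserving embedding `ψ` would carry the past time axis `s ↦ (−s, 0)` to a past-directed
  unit-speed timelike curve, whose time coordinate has derivative `≤ −1` (isometry gives `η(W, W) = −1`,
  orientation gives `W⁰ < 0`) and so drops from `0` below `−1` by parameter `2` — out of the cut.

`exists_complete_settled_not_isMaximal` packages it: the flat class contains complete, settled, NON-maximal
developments, so "Φ − {`IsMaximal`} is true on the certifiable class" (part 3) is a statement with content about
maximality — on these models completeness does all the work and maximality none. All results proved; no named facts.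

## References

* B. O'Neill, *Semi-Riemannian geometry* (1983), Ch. 3 (isometric immersions), Ch. 14, Def. 14.28.
* Y. Choquet-Bruhat, R. Geroch, CMP 14 (1969) (maximal developments); H. Ringström, *The Cauchy problem in
  general relativity* (2009), Def. 16.5.
-/

noncomputable section

open Bundle Set Function Filter TopologicalSpace Topology MeasureTheory Metric
open scoped Manifold ContDiff Topology ENNReal

set_option linter.dupNamespace false

namespace Summit.FinalStateConjecture.FinalStateConjecture.Theorems.ChannelsResolveTameDevelopmentsR.SubMinkowski

open Literature.Geometry.Lorentzian Literature.Geometry.Lorentzian.Minkowski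
open Summit.FinalStateConjecture.FinalStateConjecture.Theorems.WeakCosmicCensorshipMGHD.Negative
  (exists_hasFutureEndpoint_of_time_le apply_zero_le_of_hasPastEndpoint)
open Summit.FinalStateConjecture.FinalStateConjecture.Theorems.ChannelsResolveTameDevelopmentsR.Negative
  (le_apply_zero_of_hasFutureEndpoint exists_hasPastEndpoint_of_le_time velocity_eq_deriv)

/-! ### The past cut `{x⁰ > −1}` -/

/-- The open past-truncated Minkowski space `{x ∈ E4 | −1 < x⁰}`. -/
def pastCut : Opens E4 :=
  ⟨{x : E4 | -1 < x 0}, isOpen_lt continuous_const (EuclideanSpace.proj (0 : Fin 4)).continuous⟩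

/-- Membership in the past cut is `−1 < x⁰`. -/
@[simp] theorem mem_pastCut {x : E4} : x ∈ pastCut ↔ -1 < x 0 := Iff.rfl

/-- The slice `{x⁰ = 0}` lies in the past cut. -/
theorem sliceEmbed_mem_pastCut (y : slice) : sliceEmbed y ∈ pastCut := by
  simp [sliceEmbed_apply]

/-- The closed future half-space `{x⁰ ≥ 0}` lies in the past cut. -/
theorem future_subset_pastCut : {x : E4 | 0 ≤ x 0} ⊆ (pastCut : Set E4) :=
  fun x hx ↦ show (-1 : ℝ) < x 0 from lt_of_lt_of_le (by norm_num) hx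

/-- **The slice `{x⁰ = 0}` is a Cauchy hypersurface of the open sub-spacetime `{x⁰ > −1}` of Minkowski
space**: along an endless timelike curve of the cut the time coordinate is strictly increasing and continuous;
it takes a positive value (else the curve converges in `E4` to a point of time in `(−1, 0]`, a future endpoint IN
the cut) and a negative value (else it has a past endpoint of time `≥ 0`, in the cut), so it vanishes exactly
once. O'Neill 1983, Ch. 14, Def. 14.28. -/
theorem isCauchyHypersurface_pastCut :
    (subMetric pastCut).IsCauchyHypersurface (subOrientation pastCut)
      (range (vacuumCauchyDevelopment.embedOpens pastCut sliceEmbed_mem_pastCut)) := by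
  intro γ s hγ
  obtain ⟨hs, htl, hfut, hpast⟩ := hγ
  have h : spacetime.metric.IsFutureTimelikeCurveOn spacetime.timeOrientation (Subtype.val ∘ γ) s :=
    (LorentzianMetric.isFutureTimelikeCurveOn_restrict_iff _ _ _ _ _).1 htl
  set c : ℝ → E4 := Subtype.val ∘ γ with hc
  have hmono := strictMonoOn_time hs h
  obtain ⟨σ₀, hσ₀⟩ := hfut.1
  have hσ₀mem : -1 < c σ₀ 0 := (γ σ₀).2
  -- some value of the time coordinate is positive
  obtain ⟨b, hb, hb0⟩ : ∃ b ∈ s, 0 < c b 0 := by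
    by_contra hcon
    push Not at hcon
    obtain ⟨p, -, hp⟩ := exists_hasFutureEndpoint_of_time_le hs hfut.1 h hcon
    have hp2 : -1 < p 0 := lt_of_lt_of_le hσ₀mem (le_apply_zero_of_hasFutureEndpoint hs h hp hσ₀)
    exact hfut.2 (⟨p, hp2⟩ : pastCut) ((hasFutureEndpoint_subtypeVal_comp_iff (p := (⟨p, hp2⟩ : pastCut))).1 hp)
  -- some value of the time coordinate is negative
  obtain ⟨a, ha, ha0⟩ : ∃ a ∈ s, c a 0 < 0 := by
    by_contra hcon
    push Not at hcon
    obtain ⟨p, hp0, hp⟩ := exists_hasPastEndpoint_of_le_time hs hfut.1 h hcon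
    have hp2 : -1 < p 0 := by linarith
    exact hpast.2 (⟨p, hp2⟩ : pastCut) ((hasPastEndpoint_subtypeVal_comp_iff (p := (⟨p, hp2⟩ : pastCut))).1 hp)
  obtain ⟨σ, hσ, hσ0⟩ : ∃ σ ∈ s, c σ 0 = 0 :=
    hs.isPreconnected.intermediate_value ha hb (continuousOn_time h) ⟨ha0.le, hb0.le⟩
  obtain ⟨y, hy⟩ := (E4.mem_range_sliceEmbed_iff (c σ)).2 hσ0
  refine ⟨σ, ⟨hσ, ⟨y, Subtype.ext hy⟩⟩, ?_⟩
  rintro t ⟨ht, ⟨y', hy'⟩⟩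
  have ht0 : c t 0 = 0 := (E4.mem_range_sliceEmbed_iff (c t)).1 ⟨y', congrArg Subtype.val hy'⟩
  exact hmono.injOn ht hσ (ht0.trans hσ0.symm)

/-- **Past-truncated Minkowski space `{x⁰ > −1}` as a vacuum Cauchy development of the trivial datum**: the
member `U = {x⁰ > −1}` of the flat model class (`subDev`; the cut is a half-space, hence convex and connected). -/
abbrev pastCutDev : VacuumCauchyDevelopment trivialData :=
  subDev pastCut
    (((convex_halfSpace_gt (EuclideanSpace.proj (0 : Fin 4)).isLinear (-1)).isPathConnected
      ⟨0, by simp⟩).isConnected)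
    sliceEmbed_mem_pastCut isCauchyHypersurface_pastCut

/-- Every point of the past-cut development has time coordinate `> −1`. -/
theorem pastCutDev_apply_zero (x : pastCut) : -1 < (x : E4) 0 := x.2

/-! ### Complete and settled -/

/-- **The past cut has COMPLETE future null infinity** (it contains `{x⁰ ≥ 0}`;
`hasCompleteNullInfinity_iff_future_subset`). -/
theorem hasCompleteNullInfinity_pastCutDev :
    _root_.Summit.FinalStateConjecture.HasCompleteNullInfinity pastCutDev.toCauchyDevelopment :=
  hasCompleteNullInfinity_of_future_subset future_subset_pastCut

/-- **The past cut SETTLES**: it admits an honest exhaustive final-state `2`-decomposition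
(`settles_of_future_subset`). -/
theorem settles_pastCutDev :
    ∃ (O : Set pastCutDev.carrier) (d : FinalStateDecomposition pastCutDev.toSpacetime O 2),
      O = _root_.Summit.FinalStateConjecture.exteriorOf pastCutDev.toCauchyDevelopment d.charted ∧
        _root_.Summit.FinalStateConjecture.HasExhaustiveCharts d :=
  settles_of_future_subset future_subset_pastCut

/-! ### Not maximal -/

/-- **Signed escape lemma (real analysis).** A real function on `[0, ∞)` with `T(0) = 0` and derivative
`≤ −1` cannot stay above `−1`: by the mean value inequality `T(2) ≤ −2`. -/
theorem false_of_deriv_le_neg_one {T T' : ℝ → ℝ} (hT : ∀ s, 0 ≤ s → HasDerivAt T (T' s) s)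
    (hT' : ∀ s, 0 ≤ s → T' s ≤ -1) (h0 : T 0 = 0) (hmem : ∀ s, 0 ≤ s → -1 < T s) : False := by
  have hcont : ContinuousOn T (Icc 0 2) := fun s hs ↦ (hT s hs.1).continuousAt.continuousWithinAt
  have hdiff : DifferentiableOn ℝ T (interior (Icc 0 2)) := fun s hs ↦
    (hT s (interior_subset hs).1).differentiableAt.differentiableWithinAt
  have hle : ∀ s ∈ interior (Icc (0 : ℝ) 2), deriv T s ≤ -1 := fun s hs ↦ by
    rw [(hT s (interior_subset hs).1).deriv]
    exact hT' s (interior_subset hs).1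
  have h := (convex_Icc (0 : ℝ) 2).image_sub_le_mul_sub_of_deriv_le hcont hdiff hle 0
    ⟨le_rfl, by norm_num⟩ 2 ⟨by norm_num, le_rfl⟩ (by norm_num)
  have h2 := hmem 2 (by norm_num)
  rw [h0] at h
  linarith

/-- A past-directed unit timelike vector of Minkowski space has time component `≤ −1`:
`η(W, W) = −1` and `W⁰ < 0` give `(W⁰)² = 1 + ‖W̲‖² ≥ 1`. -/
theorem apply_zero_le_neg_one_of_bilin_eq {W : E4} (h : bilin W W = -1) (h0 : W 0 < 0) : W 0 ≤ -1 := by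
  rw [bilin_apply] at h
  have hs : 0 ≤ ∑ i : Fin 3, W i.succ * W i.succ := Finset.sum_nonneg fun i _ ↦ mul_self_nonneg _
  nlinarith

/-- **The past-cut development is NOT MAXIMAL**: Minkowski space (a vacuum Cauchy development of the same
datum) does not embed into it. An embedding `ψ` is a smooth isometric immersion preserving the time
orientations and the data embedding; along the past time axis `ℓ(s) = (0, 0) − s ∂ₜ` from the slice point
`(0, 0)`, the curve `ψ ∘ ℓ` has coordinate velocity `W(s) = dψ(−∂ₜ)` with `η(W, W) = η(∂ₜ, ∂ₜ) = −1` and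
`W⁰ < 0` (the image of `∂ₜ` is future-directed), so its time coordinate starts at `0` with derivative `≤ −1`
and leaves `{x⁰ > −1}` by `s = 2` (`false_of_deriv_le_neg_one`). Ringström 2009, Def. 16.5. -/
theorem pastCutDev_not_isMaximal : ¬ pastCutDev.IsMaximal := by
  intro h
  obtain ⟨ψ, hψ, -, hiso, hτ, hdata⟩ := h vacuumCauchyDevelopment
  change E4 → pastCut at ψ
  -- the past time axis from the slice point `(0, 0)` and its image
  set y₀ : slice := ⟨0, mem_slice _⟩ with hy₀
  set u : E4 := -E4.basisVector 0 with hu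
  set ℓ : ℝ → E4 := fun s ↦ sliceEmbed y₀ + s • u with hℓ
  set C : ℝ → E4 := fun s ↦ ((ψ (ℓ s) : pastCut) : E4) with hC
  set W : ℝ → E4 := fun s ↦ (mfderiv 𝓘(ℝ, E4) (𝓡 4) ψ (ℓ s) u : E4) with hW
  -- derivative of the image curve
  have hderiv : ∀ s, HasDerivAt C (W s) s := by
    intro s
    have hline : HasDerivAt ℓ u s := by
      simpa [hℓ] using ((hasDerivAt_id s).smul_const u).const_add (sliceEmbed y₀)
    have hℓd : MDifferentiableAt 𝓘(ℝ, ℝ) 𝓘(ℝ, E4) ℓ s :=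
      mdifferentiableAt_iff_differentiableAt.2 hline.differentiableAt
    have hℓvel : (velocity 𝓘(ℝ, E4) ℓ s : E4) = u := by rw [velocity_eq_deriv, hline.deriv]
    have hψd : MDifferentiableAt 𝓘(ℝ, E4) (𝓡 4) ψ (ℓ s) := (hψ (ℓ s)).mdifferentiableAt (by simp)
    have hcomp : MDifferentiableAt 𝓘(ℝ, ℝ) (𝓡 4) (ψ ∘ ℓ) s := hψd.comp s hℓd
    have hvelcomp : (velocity (𝓡 4) (ψ ∘ ℓ) s : E4) = W s := by
      change mfderiv 𝓘(ℝ, ℝ) (𝓡 4) (ψ ∘ ℓ) s (1 : ℝ) = _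
      rw [mfderiv_comp s hψd hℓd]
      change mfderiv 𝓘(ℝ, E4) (𝓡 4) ψ (ℓ s) (velocity 𝓘(ℝ, E4) ℓ s) = _
      rw [hℓvel]
    have hCd : MDifferentiableAt 𝓘(ℝ, ℝ) (𝓡 4) C s :=
      (mdifferentiableAt_subtypeVal_comp_curve_iff pastCut).2 hcomp
    have hCd' : DifferentiableAt ℝ C s := mdifferentiableAt_iff_differentiableAt.1 hCd
    have hCvel : (velocity (𝓡 4) C s : E4) = W s := by
      rw [← hvelcomp]
      exact velocity_subtypeVal_comp pastCut (ψ ∘ ℓ) s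
    have hCderiv : deriv C s = W s := by rw [← hCvel]; exact (velocity_eq_deriv C s).symm
    rw [← hCderiv]
    exact hCd'.hasDerivAt
  -- isometry: `η(W, W) = η(u, u) = -1`; orientation: `W⁰ < 0`
  have hWW : ∀ s, bilin (W s) (W s) = -1 := fun s ↦ by
    have h1 := DFunLike.congr_fun (DFunLike.congr_fun (hiso.2 (ℓ s)) u) u
    change bilin (mfderiv 𝓘(ℝ, E4) (𝓡 4) ψ (ℓ s) u) (mfderiv 𝓘(ℝ, E4) (𝓡 4) ψ (ℓ s) u) = bilin u u at h1
    rw [hW, h1, hu]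
    simp
  have hW0 : ∀ s, W s 0 < 0 := fun s ↦ by
    set w : E4 := (mfderiv 𝓘(ℝ, E4) (𝓡 4) ψ (ℓ s) (E4.basisVector 0) : E4) with hw
    have h1 := (hτ (ℓ s)).2
    change bilin (E4.basisVector 0) w < 0 at h1
    rw [bilin_basisVector_zero_left, neg_lt_zero] at h1
    have h2 : W s = -w := by
      rw [hW, hu, hw]
      exact map_neg _ _
    have h3 : W s 0 = -(w 0) := by rw [h2]; simp
    rw [h3]
    linarith
  -- the time coordinate starts at `0`, has derivative `≤ -1`, but stays `> -1`: contradiction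
  refine false_of_deriv_le_neg_one (T := fun s ↦ C s 0) (T' := fun s ↦ W s 0) (fun s _ ↦ ?_)
    (fun s _ ↦ apply_zero_le_neg_one_of_bilin_eq (hWW s) (hW0 s)) ?_ (fun s _ ↦ pastCutDev_apply_zero _)
  · have h1 := ((EuclideanSpace.proj (0 : Fin 4) : E4 →L[ℝ] ℝ).hasFDerivAt.comp_hasDerivAt s (hderiv s))
    simpa [Function.comp_def] using h1
  · have h0 : ℓ 0 = sliceEmbed y₀ := by simp [hℓ]
    have h1 : ψ (sliceEmbed y₀) = vacuumCauchyDevelopment.embedOpens pastCut sliceEmbed_mem_pastCut y₀ :=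
      congrFun hdata y₀
    show ((ψ (ℓ 0) : pastCut) : E4) 0 = 0
    rw [h0, h1]
    show (sliceEmbed y₀) 0 = 0
    simp [sliceEmbed_apply]

/-- **THE FLAT CLASS CONTAINS COMPLETE, SETTLED, NON-MAXIMAL DEVELOPMENTS.** Some vacuum Cauchy development of
the admissible trivial datum is not maximal, has complete `𝓘⁺` and admits an honest exhaustive final-state
decomposition (the past cut): "Φ without `IsMaximal`" (true on the certifiable class, `settles_of_hasCompleteNullInfinity`)
speaks about genuinely non-maximal developments — on these models completeness does all the work of the pair
{`IsMaximal`, complete `𝓘⁺`} and maximality none. [cite: Ringstrom2009, Def. 16.5] -/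
theorem exists_complete_settled_not_isMaximal :
    ∃ 𝒟 : VacuumCauchyDevelopment trivialData, ¬ 𝒟.IsMaximal ∧
      _root_.Summit.FinalStateConjecture.HasCompleteNullInfinity 𝒟.toCauchyDevelopment ∧
        ∃ (O : Set 𝒟.carrier) (d : FinalStateDecomposition 𝒟.toSpacetime O 2),
          O = _root_.Summit.FinalStateConjecture.exteriorOf 𝒟.toCauchyDevelopment d.charted ∧
            _root_.Summit.FinalStateConjecture.HasExhaustiveCharts d :=
  ⟨pastCutDev, pastCutDev_not_isMaximal, hasCompleteNullInfinity_pastCutDev, settles_pastCutDev⟩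

end Summit.FinalStateConjecture.FinalStateConjecture.Theorems.ChannelsResolveTameDevelopmentsR.SubMinkowski

end
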